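import Summits.Ventures.WeilGRH.UniformConductorFloorLog9Table
import HarnessLib

/-!
# GRH arm (rh-explicit, venture WeilGRH): the special-value table at `a = log 3` — validity of the constants, the prime data and the records of
  the modes `0 … 19` (kernel certificates, part A of eight)

Cell `rh-explicit`, WEIL TRACK — GRH ARM (weil-grh-1, gen9).  Kernel re-verification of every datum of `UniformConductorFloorLog9Table.lean` in the
format of `WeilFormatCDataLog3HalfTabValid.lean` (weil-2): `checkPi` (Machin, 70 terms), `checkHalfLogNat` (`a = log 3`), `checkConsts`,
`checkPrimeDataHalfLog 9`, the prime-constant floors `floors_log3` (by integer comparison, `AopFloors`), and — in the eight parts A–H, 20 modes each (≈ 4–6 s per mode in the kernel; a 25-mode slice failed to reduce at this window) — `checkTable` slices recomputing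
`Encl.idxRec` at every mode and testing containment, glued into `tab_valid : TabValid (2^80) a ks 160 tab` (part H).  With `consts_valid` /
`primeData` / `tab_valid` the table is a drop-in input for weil-grh-2's twisted cell kits (`TwistedEncl.twistedGramBox`, `evenBox` / `oddBox`, door E)
at this window.  No definitions; no named facts; standard axioms.
[cite: Yoshida1992HermitianForms, §5 (5.15)-(5.16) p. 301; Moore1966, Ch. 3 (interval arithmetic: inclusion property)]

(gen10 RE-CUT of gen9's part A: the `UniformConductorFloorAopFloors` import and the floors lemma `floors_log3` are moved to
`UniformConductorFloorLog9TableFloors.lean`, so that the validity chain depends on the table data only; parts B… import this part alone and file in parallel;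
the glue `tab_valid` is `UniformConductorFloorLog9TableValid.lean`.)
-/

set_option maxRecDepth 200000

namespace Summit.Ventures.WeilGRH.Log9Table
open Literature.NumberTheory.LFunctions Literature.NumberTheory.LFunctions.Yoshida1992 Encl Literature.Analysis.ValidatedNumerics.NumericsMP

/-- kernel: `P ∋ π`. [cite: Moore1966, Ch. 3 (interval arithmetic: inclusion property)] -/
theorem tP : checkPi (2 ^ 80) 70 P = true := by decide +kernel

/-- kernel: `A ∋ (log 8)/2`. [cite: Moore1966, Ch. 3 (interval arithmetic: inclusion property)] -/
theorem tA : checkHalfLogNat (2 ^ 80) 96 9 A = true := by decide +kernel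

/-- kernel: the constants record is valid. [cite: Moore1966, Ch. 3 (interval arithmetic: inclusion property)] -/
theorem tC : checkConsts prm P A ks C = true := by decide +kernel

/-- kernel: the prime data of the window `log 3`. [cite: Yoshida1992HermitianForms, §5 (5.15) p. 301] -/
theorem tK : checkPrimeDataHalfLog 9 ks = true := by decide +kernel

/-- `π ∈ P`. [cite: Moore1966, Ch. 3 (interval arithmetic: inclusion property)] -/
theorem pi_mem : MI.mem (2 ^ 80) Real.pi P := mem_pi_of_checkPi (by norm_num) tP

/-- `a ∈ A`. [cite: Moore1966, Ch. 3 (interval arithmetic: inclusion property)] -/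
theorem a_mem : MI.mem (2 ^ 80) a A := by
  have h := mem_of_checkHalfLogNat (S := 2 ^ 80) (by norm_num) tA
  have e : Real.log ((9 : ℕ) : ℝ) / 2 = a := by
    unfold a
    rw [show ((9 : ℕ) : ℝ) = (3 : ℝ) ^ 2 by norm_num, Real.log_pow]
    push_cast
    ring
  rwa [e] at h

/-- `0 < a`. [folklore] -/
theorem a_pos : (0 : ℝ) < a := by
  unfold a
  exact Real.log_pos (by norm_num)

/-- The constants are valid for `a = log 3`. [cite: Moore1966, Ch. 3 (interval arithmetic: inclusion property)] -/
theorem consts_valid : ConstsValid (2 ^ 80) a ks C :=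
  constsValid_of_checkConsts (prm := prm) (by norm_num [prm]) (by norm_num [prm]) pi_mem a_mem tC

/-- The prime data is valid for `a = log 3`. [cite: Yoshida1992HermitianForms, §5 (5.15) p. 301] -/
theorem primeData : PrimeData a ks := by
  have h := primeData_of_checkHalfLog tK
  have e : Real.log ((9 : ℕ) : ℝ) / 2 = a := by
    unfold a
    rw [show ((9 : ℕ) : ℝ) = (3 : ℝ) ^ 2 by norm_num, Real.log_pow]
    push_cast
    ring
  rwa [e] at h

/-- kernel: table slice `[0, 20)`. [cite: Moore1966, Ch. 3 (interval arithmetic: inclusion property)] -/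
theorem tT0 : checkTable prm C tab 0 20 = true := by decide +kernel

/-- The table is valid below `20`. [cite: Moore1966, Ch. 3 (interval arithmetic: inclusion property)] -/
theorem tab_valid20 : TabValid (2 ^ 80) a ks (0 + 20) tab :=
  TabValid.zero.extend fun n hn hnk ↦ idxValid_of_checkTable (prm := prm) (by norm_num [prm]) a_pos consts_valid tT0 hn hnk

end Summit.Ventures.WeilGRH.Log9Table
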